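import Literature.MathematicalPhysics.QuantumFieldTheory.LatticeMassGap
import Literature.MathematicalPhysics.QuantumLattice.LatticeGaugeDLR

/-! Scratch: convention checks for the reshaped skeleton's `gaugeTimeReflect` / `gaugeTimeShift`
(copied verbatim from Lines/spectral-requantisation-dock.lean, pasted-vocabulary section). -/

open Literature.MathematicalPhysics.QuantumFieldTheory Literature.MathematicalPhysics.QuantumLattice
open Literature.Probability.LatticeModels

namespace DrefuteGeom

variable {G : Type} [Group G] [MeasurableSpace G]

set_option linter.unusedSectionVars false

def gaugeTimeReflect (U : LGConfig 4 G) : LGConfig 4 G := fun e =>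
  if e.2 = 0 then (U (latticeTimeReflection 4 (e.1 + Pi.single 0 1), 0))⁻¹
  else U (latticeTimeReflection 4 e.1, e.2)

def gaugeTimeShift : LGConfig 4 G → LGConfig 4 G :=
  configShift (G := G) (-(Pi.single (0 : Fin 4) (1 : ℤ)))

@[simp] theorem gaugeTimeShift_apply (U : LGConfig 4 G) (e : ZdEdge 4) :
    gaugeTimeShift U e = U (e.1 + Pi.single 0 1, e.2) := by
  simp [gaugeTimeShift, sub_neg_eq_add]

/-- inverse shift -/
def gaugeTimeShiftInv : LGConfig 4 G → LGConfig 4 G :=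
  configShift (G := G) (Pi.single (0 : Fin 4) (1 : ℤ))

@[simp] theorem gaugeTimeShiftInv_apply (U : LGConfig 4 G) (e : ZdEdge 4) :
    gaugeTimeShiftInv U e = U (e.1 - Pi.single 0 1, e.2) := by
  simp [gaugeTimeShiftInv]

theorem shift_shiftInv (U : LGConfig 4 G) : gaugeTimeShift (gaugeTimeShiftInv U) = U := by
  funext e; simp

theorem shiftInv_shift (U : LGConfig 4 G) : gaugeTimeShiftInv (gaugeTimeShift U) = U := by
  funext e; simp

theorem reflSite_add (x : Site 4) :
    latticeTimeReflection 4 (x + Pi.single 0 1) = latticeTimeReflection 4 x - Pi.single 0 1 := by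
  ext j; by_cases h : j = 0
  · subst h; simp; ring
  · simp [h]

theorem reflSite_sub (x : Site 4) :
    latticeTimeReflection 4 (x - Pi.single 0 1) = latticeTimeReflection 4 x + Pi.single 0 1 := by
  ext j; by_cases h : j = 0
  · subst h; simp; ring
  · simp [h]

theorem reflSite_invol (x : Site 4) : latticeTimeReflection 4 (latticeTimeReflection 4 x) = x := by
  ext j; by_cases h : j = 0
  · subst h; simp
  · simp [h]

theorem reflSite_invol' (x : Site 4) :
    latticeTimeReflection 4 (latticeTimeReflection 4 (x + Pi.single 0 1) + Pi.single 0 1) = x := by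
  rw [reflSite_add, reflSite_invol, add_sub_cancel_right]

/-- Θ is an involution. -/
theorem reflect_reflect (U : LGConfig 4 G) : gaugeTimeReflect (gaugeTimeReflect U) = U := by
  funext e
  obtain ⟨x, i⟩ := e
  by_cases h : i = 0
  · subst h
    simp only [gaugeTimeReflect, if_true, inv_inv, reflSite_invol']
  · simp only [gaugeTimeReflect, h, if_false, reflSite_invol]

/-- GJ 6.1.3 (ii): Θ ∘ τ⁻¹ = τ ∘ Θ (needed for `shift_symm` from τ-invariance). -/
theorem reflect_shiftInv (U : LGConfig 4 G) :
    gaugeTimeReflect (gaugeTimeShiftInv U) = gaugeTimeShift (gaugeTimeReflect U) := by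
  funext e
  obtain ⟨x, i⟩ := e
  by_cases h : i = 0
  · subst h
    simp only [gaugeTimeReflect, if_true, gaugeTimeShiftInv_apply, gaugeTimeShift_apply,
      reflSite_add]
  · simp only [gaugeTimeReflect, h, if_false, gaugeTimeShiftInv_apply, gaugeTimeShift_apply,
      reflSite_add]

/-- The half-step reflection Θ₁ := τ ∘ Θ is the SITE reflection x₀ ↦ -2 - x₀ on spatial links. -/
theorem shift_reflect_spatial (U : LGConfig 4 G) (x : Site 4) (i : Fin 4) (hi : i ≠ 0) :
    gaugeTimeShift (gaugeTimeReflect U) (x, i) = U (Function.update x 0 (-2 - x 0), i) := by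
  simp only [gaugeTimeShift_apply, gaugeTimeReflect, hi, if_false]
  congr 2
  ext j; by_cases hj : j = (0 : Fin 4)
  · subst hj; simp; ring
  · simp [hj]

/-- Θ maps a positive-time spatial link to one based at time ≤ -1, and a positive-time temporal
link `(x,0)`, `x₀ ≥ 0`, reads the temporal link based at time `-2 - x₀ ≤ -2`. -/
theorem reflect_base_time (x : Site 4) :
    (latticeTimeReflection 4 x) 0 = -1 - x 0 ∧
      (latticeTimeReflection 4 (x + Pi.single 0 1)) 0 = -2 - x 0 := by
  constructor
  · simp
  · simp; ring

theorem reflSite_add_spatial (x : Site 4) {i : Fin 4} (hi : i ≠ 0) :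
    latticeTimeReflection 4 (x + Pi.single i 1) = latticeTimeReflection 4 x + Pi.single i 1 := by
  ext j; by_cases hj : j = 0
  · subst hj; simp [hi.symm]
  · by_cases hji : j = i
    · subst hji; simp [hj]
    · simp [hj, Pi.single_apply, hji]

/-- Θ intertwines gauge transformations: `Θ (U^g) = (Θ U)^{g ∘ θ}` — so `A ∘ Θ` is gauge
invariant whenever `A` is (needed to feed H with the reflected observable in RQb2). -/
theorem reflect_gaugeTransform (g : Site 4 → G) (U : LGConfig 4 G) :
    gaugeTimeReflect (gaugeTransformZd g U) =
      gaugeTransformZd (g ∘ latticeTimeReflection 4) (gaugeTimeReflect U) := by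
  funext e
  obtain ⟨x, i⟩ := e
  by_cases h : i = 0
  · subst h
    simp only [gaugeTimeReflect, if_true, gaugeTransformZd, Function.comp_apply, mul_inv_rev,
      inv_inv, reflSite_add, sub_add_cancel, mul_assoc]
  · simp only [gaugeTimeReflect, h, if_false, gaugeTransformZd, Function.comp_apply,
      reflSite_add_spatial x h]

theorem isZdGaugeInvariant_comp_reflect {α : Type*} {F : LGConfig 4 G → α}
    (hF : IsZdGaugeInvariant F) : IsZdGaugeInvariant (F ∘ gaugeTimeReflect) := by
  intro g U
  simp only [Function.comp_apply, reflect_gaugeTransform, hF _ _]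

end DrefuteGeom
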